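import Summits.QuantumFields.QCD.Theorems.PauliWegnerSeaChiralOneScaleTrajectoryJensenPointwise
import Summits.QuantumFields.QCD.Theorems.PauliWegnerSeaChiralOneScaleTrajectoryTransferAE
import Summits.QuantumFields.QCD.Theorems.PauliWegnerSeaChiralOneScaleTrajectoryBridges

/-!
# The converse dictionary entry: an honest lattice gap bounds the axis fractional moments
(line `Sketch`, crux `PauliWegnerSea.ChiralOneScaleTrajectory`, stmt-QuantumFields-17512; card
one-volume-goldstone-witness item 2: "honest gap and FM rate are ONE function up to the factor 2/s")

At `N_f = 2` and a degenerate bare-mass tuple `(m, m)`: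
* `secondMoment_le_of_hasLatticeMassGap_two` — `HasLatticeMassGap ε` for `reg.scheme (m,m)` bounds the
  `|det|`-weighted second moment of the flavour-`f` propagator block on the time axis,
  `E₊[Σ|G_f(0, n e₀)|²] ≤ C e^{-ε a_k n}` eventually in `k`, for all `S ≥ L_k`, `n ≤ S` — because that
  second moment IS (minus) the honest connected charged-pion correlator (`pionCorr_eq_neg_signedQuotient`,
  `det D = |det D|` at `N_f = 2`).
* `fm_le_of_hasLatticeMassGap_two` — hence, by the pointwise Jensen inequality
  `(E₊[X^s])^{2/s} ≤ 144 E₊[Σ|G|²]`, the crux's own fractional moment decays on the axis at rate `sε/2`: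
  `E₊[X^s] ≤ (144 C)^{s/2} e^{-(sε/2) a_k n}` (`0 < s ≤ 2`) — an UPPER bound of the shape of clause (ii)
  of `MobilityGap` restricted to the time axis.
Dually to the proved chain (lower pins with vanishing rate ⇒ chirality), this shows: a uniform honest gap
`ε₀` at all small degenerate masses forces the rate floor `sε₀/2` on every axis lower pin of clause
(iii) — NoCollapse₂ is not only sufficient but necessary for `reg.IsChiralAtZero` along degenerate tuples.
Folklore bookkeeping over the tree's objects.
-/

noncomputable section

namespace Summit.QuantumFields.QCD.Cruxes.ChiralOneScaleTrajectory.GoldstoneWitness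

open scoped BigOperators
open MeasureTheory Filter
open Literature.MathematicalPhysics.QuantumFieldTheory Literature.MathematicalPhysics.QuantumLattice
  Literature.Probability.LatticeModels

/-- **Honest gap ⇒ second-moment decay on the axis (`N_f = 2`, degenerate tuple).** -/
theorem secondMoment_le_of_hasLatticeMassGap_two :
    ∀ (reg : QCDRegularisation 2) (f g : Fin 2), f ≠ g → ∀ (m ε : ℝ), (reg.scheme (fun _ : Fin 2 => m) 0 0).HasLatticeMassGap ε → ∃ C : ℝ, ∀ᶠ k in atTop, ∀ S : ℕ, reg.L k ≤ S → ∀ n : ℕ, n ≤ S → (∫ U : GaugeConfig 4 (2 * S + 1) (Matrix.specialUnitaryGroup (Fin 3) ℂ), ‖(diracMatrix U fun _ : Fin 2 => reg.mcrit k + reg.a k * m / reg.Zm k).det‖ * (∑ a : Fin 3, ∑ i : Fin 4, ∑ b : Fin 3, ∑ j : Fin 4, ‖(diracMatrix U fun _ : Fin 2 => reg.mcrit k + reg.a k * m / reg.Zm k)⁻¹ (quarkEquiv (f, (Torus.proj (2 * S + 1) 0, a, i))) (quarkEquiv (f, (Torus.proj (2 * S + 1) (Pi.single 0 (n : ℤ)),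 b, j)))‖ ^ (2 : ℕ)) ∂(wilsonMeasure (fundamentalRep (Fin 3)) (reg.β k))) / (∫ U : GaugeConfig 4 (2 * S + 1) (Matrix.specialUnitaryGroup (Fin 3) ℂ), ‖(diracMatrix U fun _ : Fin 2 => reg.mcrit k + reg.a k * m / reg.Zm k).det‖ ∂(wilsonMeasure (fundamentalRep (Fin 3)) (reg.β k))) ≤ C * Real.exp (-(ε * (reg.a k * n))) := by
  intro reg f g hfg m ε hgap
  obtain ⟨C, hC⟩ := hgap 1 1 (pseudoscalarDensityObs 2 (Matrix.single g f (1 : ℂ)))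
    (pseudoscalarDensityObs 2 (Matrix.single f g (1 : ℂ)))
  refine ⟨C, hC.mono fun k hk S hS n hn => ?_⟩
  have hle := hk S hS n hn
  have hmq : (fun fl => (reg.scheme (fun _ : Fin 2 => m) 0 0).mq fl k) =
      fun _ : Fin 2 => reg.mcrit k + reg.a k * m / reg.Zm k := by
    funext fl
    simp [QCDRegularisation.scheme_mq]
  rw [hmq, pionCorr_eq_neg_signedQuotient _ _ hfg rfl n, norm_neg] at hle
  -- at `N_f = 2` the signed quotient is the real non-negative unsigned one
  set mq : Fin 2 → ℝ := fun _ => reg.mcrit k + reg.a k * m / reg.Zm k with hmqdef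
  set μ := wilsonMeasure (d := 4) (L := 2 * S + 1) (fundamentalRep (Fin 3)) (reg.β k) with hμ
  set X : GaugeConfig 4 (2 * S + 1) (Matrix.specialUnitaryGroup (Fin 3) ℂ) → ℝ := fun U =>
    ∑ a : Fin 3, ∑ i : Fin 4, ∑ b : Fin 3, ∑ j : Fin 4,
      ‖(diracMatrix U mq)⁻¹ (quarkEquiv (f, (Torus.proj (2 * S + 1) 0, a, i)))
        (quarkEquiv (f, (Torus.proj (2 * S + 1) (Pi.single 0 (n : ℤ)), b, j)))‖ ^ (2 : ℕ) with hX
  have hdet : ∀ U : GaugeConfig 4 (2 * S + 1) (Matrix.specialUnitaryGroup (Fin 3) ℂ),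
      (diracMatrix U mq).det = ((‖(diracMatrix U mq).det‖ : ℝ) : ℂ) := fun U =>
    det_diracMatrix_two_degenerate_eq_norm U _
  have hnum : (∫ U, (diracMatrix U mq).det * ((X U : ℝ) : ℂ) ∂μ) =
      ((∫ U, ‖(diracMatrix U mq).det‖ * X U ∂μ : ℝ) : ℂ) := by
    rw [← integral_complex_ofReal]
    refine integral_congr_ae (Eventually.of_forall fun U => ?_)
    beta_reduce
    rw [Complex.ofReal_mul, ← hdet U]
  have hden : (∫ U, (diracMatrix U mq).det ∂μ) = ((∫ U, ‖(diracMatrix U mq).det‖ ∂μ : ℝ) : ℂ) := by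
    rw [← integral_complex_ofReal]
    exact integral_congr_ae (Eventually.of_forall fun U => hdet U)
  change ‖(∫ U, (diracMatrix U mq).det * ((X U : ℝ) : ℂ) ∂μ) / (∫ U, (diracMatrix U mq).det ∂μ)‖ ≤
    C * Real.exp (-(ε * ((reg.scheme (fun _ : Fin 2 => m) 0 0).a k * n))) at hle
  rw [hnum, hden, ← Complex.ofReal_div, Complex.norm_real, Real.norm_eq_abs] at hle
  exact (le_abs_self _).trans hle

/-- **Honest gap ⇒ axis fractional-moment decay at rate `sε/2` (`N_f = 2`, degenerate tuple, `0 < s ≤ 2`).** -/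
theorem fm_le_of_hasLatticeMassGap_two :
    ∀ (reg : QCDRegularisation 2) (f g : Fin 2), f ≠ g → ∀ (m ε s : ℝ), 0 < s → s ≤ 2 → (reg.scheme (fun _ : Fin 2 => m) 0 0).HasLatticeMassGap ε → ∃ C : ℝ, ∀ᶠ k in atTop, ∀ S : ℕ, reg.L k ≤ S → ∀ n : ℕ, n ≤ S → (∫ U : GaugeConfig 4 (2 * S + 1) (Matrix.specialUnitaryGroup (Fin 3) ℂ), ‖(diracMatrix U fun _ : Fin 2 => reg.mcrit k + reg.a k * m / reg.Zm k).det‖ * (∑ a : Fin 3, ∑ i : Fin 4, ∑ b : Fin 3, ∑ j : Fin 4, ‖(diracMatrix U fun _ : Fin 2 => reg.mcrit k + reg.a k * m / reg.Zm k)⁻¹ (quarkEquiv (f, (Torus.proj (2 * S + 1) 0, a, i))) (quarkEquiv (f, (Torus.proj (2 * S + 1) (Pi.single 0 (n : ℤ)), b, j)))‖) ^ s ∂(wilsonMeasure (fundamentalRep (Fin 3)) (reg.β k))) / (∫ U : GaugeConfig 4 (2 * S + 1) (Matrix.specialUnitaryGroup (Fin 3) ℂ), ‖(diracMatrix U fun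 _ : Fin 2 => reg.mcrit k + reg.a k * m / reg.Zm k).det‖ ∂(wilsonMeasure (fundamentalRep (Fin 3)) (reg.β k))) ≤ (144 * max C 0) ^ (s / 2) * Real.exp (-(s * ε / 2 * (reg.a k * n))) := by
  intro reg f g hfg m ε s hs hs2 hgap
  obtain ⟨C, hC⟩ := secondMoment_le_of_hasLatticeMassGap_two reg f g hfg m ε hgap
  refine ⟨C, hC.mono fun k hk S hS n hn => ?_⟩
  have hQ2 := hk S hS n hn
  have hpt := fm_rpow_le_secondMoment_two (2 * S + 1) (reg.β k) (reg.mcrit k + reg.a k * m / reg.Zm k) s hs hs2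
    f (Torus.proj (2 * S + 1) 0) (Torus.proj (2 * S + 1) (Pi.single 0 (n : ℤ)))
  set FM : ℝ := (∫ U : GaugeConfig 4 (2 * S + 1) (Matrix.specialUnitaryGroup (Fin 3) ℂ),
      ‖(diracMatrix U fun _ : Fin 2 => reg.mcrit k + reg.a k * m / reg.Zm k).det‖ *
        (∑ a : Fin 3, ∑ i : Fin 4, ∑ b : Fin 3, ∑ j : Fin 4,
          ‖(diracMatrix U fun _ : Fin 2 => reg.mcrit k + reg.a k * m / reg.Zm k)⁻¹
              (quarkEquiv (f, (Torus.proj (2 * S + 1) 0, a, i)))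
              (quarkEquiv (f, (Torus.proj (2 * S + 1) (Pi.single 0 (n : ℤ)), b, j)))‖) ^ s
        ∂(wilsonMeasure (fundamentalRep (Fin 3)) (reg.β k))) /
      (∫ U : GaugeConfig 4 (2 * S + 1) (Matrix.specialUnitaryGroup (Fin 3) ℂ),
        ‖(diracMatrix U fun _ : Fin 2 => reg.mcrit k + reg.a k * m / reg.Zm k).det‖
          ∂(wilsonMeasure (fundamentalRep (Fin 3)) (reg.β k))) with hFMdef
  set Q2 : ℝ := (∫ U : GaugeConfig 4 (2 * S + 1) (Matrix.specialUnitaryGroup (Fin 3) ℂ),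
      ‖(diracMatrix U fun _ : Fin 2 => reg.mcrit k + reg.a k * m / reg.Zm k).det‖ *
        (∑ a : Fin 3, ∑ i : Fin 4, ∑ b : Fin 3, ∑ j : Fin 4,
          ‖(diracMatrix U fun _ : Fin 2 => reg.mcrit k + reg.a k * m / reg.Zm k)⁻¹
              (quarkEquiv (f, (Torus.proj (2 * S + 1) 0, a, i)))
              (quarkEquiv (f, (Torus.proj (2 * S + 1) (Pi.single 0 (n : ℤ)), b, j)))‖ ^ (2 : ℕ))
        ∂(wilsonMeasure (fundamentalRep (Fin 3)) (reg.β k))) /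
      (∫ U : GaugeConfig 4 (2 * S + 1) (Matrix.specialUnitaryGroup (Fin 3) ℂ),
        ‖(diracMatrix U fun _ : Fin 2 => reg.mcrit k + reg.a k * m / reg.Zm k).det‖
          ∂(wilsonMeasure (fundamentalRep (Fin 3)) (reg.β k))) with hQ2def
  change FM ^ (2 / s) ≤ 144 * Q2 at hpt
  change Q2 ≤ C * Real.exp (-(ε * (reg.a k * n))) at hQ2
  change FM ≤ (144 * max C 0) ^ (s / 2) * Real.exp (-(s * ε / 2 * (reg.a k * n)))
  have hFM0 : 0 ≤ FM := by
    rw [hFMdef]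
    refine div_nonneg (integral_nonneg fun U => mul_nonneg (norm_nonneg _) (Real.rpow_nonneg ?_ _))
      (integral_nonneg fun U => norm_nonneg _)
    exact Finset.sum_nonneg fun a _ => Finset.sum_nonneg fun i _ => Finset.sum_nonneg fun b _ =>
      Finset.sum_nonneg fun j _ => norm_nonneg _
  have hexp0 : 0 < Real.exp (-(ε * (reg.a k * n))) := Real.exp_pos _
  have hbound : FM ^ (2 / s) ≤ 144 * max C 0 * Real.exp (-(ε * (reg.a k * n))) := by
    refine hpt.trans ?_
    have : Q2 ≤ max C 0 * Real.exp (-(ε * (reg.a k * n))) :=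
      hQ2.trans (mul_le_mul_of_nonneg_right (le_max_left _ _) hexp0.le)
    nlinarith [this]
  have h2s : 0 < 2 / s := by positivity
  have hs2' : 0 < s / 2 := by positivity
  -- apply `^(s/2)` to both sides
  have h1 : (FM ^ (2 / s)) ^ (s / 2) ≤ (144 * max C 0 * Real.exp (-(ε * (reg.a k * n)))) ^ (s / 2) :=
    Real.rpow_le_rpow (Real.rpow_nonneg hFM0 _) hbound hs2'.le
  rw [← Real.rpow_mul hFM0, show 2 / s * (s / 2) = 1 by field_simp, Real.rpow_one,
    Real.mul_rpow (by positivity) hexp0.le] at h1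
  have hexp : Real.exp (-(ε * (reg.a k * n))) ^ (s / 2) = Real.exp (-(s * ε / 2 * (reg.a k * n))) := by
    rw [← Real.exp_mul]; congr 1; ring
  rwa [hexp] at h1

end Summit.QuantumFields.QCD.Cruxes.ChiralOneScaleTrajectory.GoldstoneWitness

end
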